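import Mathlib
import Literature.Analysis.FluidPDE.VectorCalculus
import Literature.Analysis.FluidPDE.VorticityCalculus
import Literature.Analysis.FluidPDE.AxisymmetricEuler
import Literature.Analysis.FluidPDE.AxisymmetricVorticityTransport
import Literature.Analysis.FluidPDE.AxisymNoSwirlVorticity
import Summits.NavierStokesRegularity.NavierStokesRegularity.Theorems.ThreadingFluxPoloidalLiouvillePrecessionSwirl
import HarnessLib

/-!
# Crux `PoloidalLiouville` (stmt-NavierStokesRegularity-1222, W1), crux idea «silent-shells» (ns-idea-15 g8):
# axis pinning (Z) and no-swirl at an axis point (I3′) — Theorems-side ports of the sketch's kernel lemmas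

Ports of two kernel lemmas of `Cruxes/PoloidalLiouville/SilentShellsSketch.lean` v1.3 (critic menu ns-wall-crit-1 g4 04:22:41Z),
so that Theorems files can import them:

* `SilentShells.axisPinning_dichotomy` (Z — AXIS PINNING): if an axisymmetric `C¹` field has vorticity tangent to the spheres
  about the point `−a`, then either `a` lies on the symmetry axis or the field is irrotational.  (Rotating the tangency gives
  `ω(y) ⊥ y + R_θ a` for all `θ`; if `(a₀, a₁) ≠ 0` the differences span the horizontal plane, so `ω = ω₂ e_z`, and then
  `ω₂ (y₂ + a₂) = 0` kills `ω` off one plane; continuity closes the plane.)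
* `SilentShells.hasNoSwirl_of_isAxisymmetric_of_unthreaded_axisPoint` (I3 at an axis point, `C¹` version): an axisymmetric `C¹`
  field whose vorticity is tangent to the spheres about an axis point `−a` has no swirl — the landed swirl lemma
  `ThreadingFluxPoloidalLiouvillePrecessionSwirl.unthreadedAxisymmetricNoSwirl` at `c = −a₂`.

Helper theorems (`--supports 1222`); NS regularity is NOT proved by any of this.
-/

-- the summit and its single problem share the name (D-0017 nested layout)
set_option linter.dupNamespace false

noncomputable section

namespace Summit.NavierStokesRegularity.NavierStokesRegularity.Theorems.PoloidalLiouville.SilentShells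

open Set Function Filter Topology Metric
open scoped Topology RealInnerProductSpace
open Literature.Analysis.FluidPDE

/-- **Z — axis pinning.** If an axisymmetric `C¹` field has vorticity tangent to the spheres about the point `−a`, then either
`a` lies on the symmetry axis or the field is irrotational. -/
theorem axisPinning_dichotomy {w : EuclideanSpace ℝ (Fin 3) → EuclideanSpace ℝ (Fin 3)} (hax : IsAxisymmetric w)
    (hw : ContDiff ℝ 1 w) (a : EuclideanSpace ℝ (Fin 3))
    (hun : ∀ y, ⟪y + a, curl w y⟫ = 0) : (a 0 = 0 ∧ a 1 = 0) ∨ ∀ y, curl w y = 0 := by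
  by_cases ha : a 0 = 0 ∧ a 1 = 0
  · exact Or.inl ha
  refine Or.inr ?_
  have hd : Differentiable ℝ w := hw.differentiable one_ne_zero
  have hωax : IsAxisymmetric (curl w) := hax.curl hd
  have hadd : ∀ (θ : ℝ) (u v : EuclideanSpace ℝ (Fin 3)), rotZ θ (u + v) = rotZ θ u + rotZ θ v :=
    fun θ u v => (rotZLIE θ).map_add u v
  have hinner : ∀ (θ : ℝ) (u v : EuclideanSpace ℝ (Fin 3)), ⟪rotZ θ u, rotZ θ v⟫ = ⟪u, v⟫ := fun θ u v => by
    simpa using (rotZLIE θ).inner_map_map u v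
  have hback : ∀ (θ : ℝ) (u : EuclideanSpace ℝ (Fin 3)), rotZ (-θ) (rotZ θ u) = u := fun θ u => by
    rw [← rotZ_add, neg_add_cancel, rotZ_zero]
  -- rotated tangency: `ω(y) ⊥ y + R_θ a` for every `θ`
  have hrot : ∀ θ y, ⟪y + rotZ θ a, curl w y⟫ = 0 := by
    intro θ y
    have h := hun (rotZ (-θ) y)
    rw [hωax (-θ) y] at h
    have e : rotZ (-θ) y + a = rotZ (-θ) (y + rotZ θ a) := by
      rw [hadd, hback]
    rwa [e, hinner] at h
  have hne : a 0 ^ 2 + a 1 ^ 2 ≠ 0 := by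
    intro h0
    apply ha
    have h0' : a 0 ^ 2 = 0 ∧ a 1 ^ 2 = 0 := by
      constructor <;> nlinarith [sq_nonneg (a 0), sq_nonneg (a 1)]
    exact ⟨pow_eq_zero_iff (n := 2) two_ne_zero |>.1 h0'.1, pow_eq_zero_iff (n := 2) two_ne_zero |>.1 h0'.2⟩
  -- the vorticity vanishes off the plane `y₂ = −a₂`
  have hoff : ∀ y, y 2 + a 2 ≠ 0 → curl w y = 0 := by
    intro y hy
    have e0 := hrot 0 y
    have eπ := hrot Real.pi y
    have eπ2 := hrot (Real.pi / 2) y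
    rw [rotZ_zero] at e0
    simp only [PiLp.inner_apply, Fin.sum_univ_three, PiLp.add_apply, rotZ_apply_zero, rotZ_apply_one,
      rotZ_apply_two, Real.cos_pi, Real.sin_pi, Real.cos_pi_div_two, Real.sin_pi_div_two,
      RCLike.inner_apply, conj_trivial] at e0 eπ eπ2
    have h0 : curl w y 0 = 0 := by
      have : (a 0 ^ 2 + a 1 ^ 2) * curl w y 0 = 0 := by
        linear_combination (a 0 / 2 + a 1 / 2) * e0 + (a 1 / 2 - a 0 / 2) * eπ - a 1 * eπ2
      exact (mul_eq_zero.mp this).resolve_left hne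
    have h1 : curl w y 1 = 0 := by
      have : (a 0 ^ 2 + a 1 ^ 2) * curl w y 1 = 0 := by
        linear_combination (a 1 / 2 - a 0 / 2) * e0 + (-(a 1 / 2) - a 0 / 2) * eπ + a 0 * eπ2
      exact (mul_eq_zero.mp this).resolve_left hne
    have h2 : curl w y 2 = 0 := by
      have : (y 2 + a 2) * curl w y 2 = 0 := by
        linear_combination e0 - (y 0 + a 0) * h0 - (y 1 + a 1) * h1
      exact (mul_eq_zero.mp this).resolve_left hy
    ext i
    fin_cases i
    · exact h0
    · exact h1
    · exact h2
  -- continuity closes the plane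
  have hcont : Continuous (curl w) := continuous_curl hw
  intro y
  by_cases hy : y 2 + a 2 ≠ 0
  · exact hoff y hy
  push Not at hy
  set e2 : EuclideanSpace ℝ (Fin 3) := EuclideanSpace.single 2 1 with he2
  have hpath : Continuous (fun s : ℝ => curl w (y + s • e2)) :=
    hcont.comp (continuous_const.add (continuous_id.smul continuous_const))
  have hlim : Tendsto (fun s : ℝ => curl w (y + s • e2)) (𝓝[≠] 0) (𝓝 (curl w y)) := by
    have h := hpath.tendsto 0
    simp only [zero_smul, add_zero] at h
    exact h.mono_left nhdsWithin_le_nhds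
  have hzero : ∀ s : ℝ, s ≠ 0 → curl w (y + s • e2) = 0 := by
    intro s hs
    apply hoff
    have : (y + s • e2) 2 + a 2 = s := by
      simp [he2]
      linarith
    rw [this]
    exact hs
  have hlim0 : Tendsto (fun s : ℝ => curl w (y + s • e2)) (𝓝[≠] 0) (𝓝 0) :=
    tendsto_const_nhds.congr' (eventually_nhdsWithin_of_forall fun s hs => (hzero s hs).symm)
  exact tendsto_nhds_unique hlim hlim0

/-- **I3 at a point of the axis (`C¹` version).** An axisymmetric `C¹` field whose vorticity is tangent to the spheres about an
axis point `−a` (`a₀ = a₁ = 0`) has no swirl. -/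
theorem hasNoSwirl_of_isAxisymmetric_of_unthreaded_axisPoint {V : EuclideanSpace ℝ (Fin 3) → EuclideanSpace ℝ (Fin 3)}
    (hax : IsAxisymmetric V) (hV : ContDiff ℝ 1 V) {a : EuclideanSpace ℝ (Fin 3)} (ha : a 0 = 0 ∧ a 1 = 0)
    (hun : ∀ y, ⟪y + a, curl V y⟫ = 0) : HasNoSwirl V := by
  refine ThreadingFluxPoloidalLiouvillePrecessionSwirl.unthreadedAxisymmetricNoSwirl V (-(a 2)) hV hax ?_
  intro y
  have he : y - EuclideanSpace.single (2 : Fin 3) (-(a 2)) = y + a := by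
    ext i; fin_cases i <;> simp [ha.1, ha.2]
  rw [he]
  exact hun y

end Summit.NavierStokesRegularity.NavierStokesRegularity.Theorems.PoloidalLiouville.SilentShells

end
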